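/-
Copyright (c) 2026 the pub-hodgecm-mathlib formalisation cell (harness21).  Prover seat hodgecm-mathlib-K2E5-p17 (g8), Track B «K2-LIT»,
#184♮ = hLiu418 = `stmt-HodgeConjecture-24832`; socket #41 — THE TOP, edition 4a «KIND 0»: the constant-term package assembled from the three cells of ★ O41.4
(author of record, LEAD F0P6-plan (g14) BATCH #46 (a)).  THEOREMS ONLY (no `def`, no `instance`, no notation, no named-fact hypothesis, no `sorry`); NO `Lines` import.
-/
import Summits.HodgeConjecture.HodgeConjecture.Theorems.K2LiuSiegelEisensteinContinuationTopKinds   -- ★ editions 1–3b (this seat): the KIND-0 binder shapes, merge devices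
import Summits.HodgeConjecture.HodgeConjecture.Theorems.K2LiuConstantTermDelta                     -- ★ O41.4 `constTerm_three_cells`
import Literature.NumberTheory.Automorphic.AdelicHeightGLContinuity                                 -- ★ `continuous_adelicHeightGL`
import HarnessLib

/-!
# Crux `HLiu418`, socket #41 — THE TOP, edition 4a: THE CONSTANT-TERM PACKAGE (KIND 0) FROM THE THREE CELLS —
# `Ec₀ := (∏_{p∈P}(s−p))·f_s + E₈ + E₇` (identity cell · big-cell package · middle-cell package), its five KIND-0 letters for ★ edition 3b

Cell `hodgecm-mathlib`, crux item hLiu418 = `stmt-HodgeConjecture-24832` (helper lane until the typist's tie; count-neutral).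

★ O41.4 `K2LiuConstantTermDelta.constTerm_three_cells` (weight-normalised, orbit form): on the convergence half-plane, for a continuous Siegel section `f_s` and the Fourier carrier
`(νN, β)`, `∫ β(u)·E^Δ(uh; f_s) dνN(u) = (∫β)·f_s(h) + M(s)f_s(h) + MID(s,h)` (identity cell, big cell ★ `intertwiningDelta`, middle orbits over `REST`); with ★ Φ1
`fourierCoeffDelta_zero_index` (`ψ_0 ≡ 1`) the `S = 0` coefficient is `f_s(h) + (∫β)⁻¹·M(s)f_s(h) + (∫β)⁻¹·MID(s,h)`.  The big cell and the middle cell arrive as TERM PACKAGES in the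
common 4-clause currency (★ Φ8 `K2LiuBigCellPackageOfFaces.exists_bigCell_package` with (MOD) ★ + growth face; ★ G5-a `exists_middle_package`) — here BY VALUE as their OUTPUTS
`E₈`, `E₇` with clauses (i)(ii)(iv)(v) relative to the normalised terms `(∫β)⁻¹·M(s)f_s(h)` and `(∫β)⁻¹·MID(s,h)`; the identity cell is `(∏(s−p))·f_s(h)` with `f` holomorphic in `s`
(★ `IsHolomorphicSectionFamily`, i.e. `hstd.1.2`), continuous, of moderate growth (G7 letter `hfgr`, by value).
THIS FILE assembles the KIND-0 binders of ★ `siegelEisensteinContinuation_of_kinds_fixedCarrier` — `Ec₀`, (i) `hd₀`, (ii) `hc₀`, the coefficient identity `hcoef₀` for THAT carrier, the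
local bound `hbd₀`, the growth `hgr₀` — the local bound being DERIVED from growth + continuity of ★ `adelicHeightGL` + the height floor (`localBound_of_growth`, no local compactness used).
HEAD **`exists_constantTerm_package`** `: ∃ Ec₀, hd₀ ∧ hc₀ ∧ hcoef₀ ∧ hbd₀ ∧ hgr₀` (shapes = ★ edition 3b's binders VERBATIM).
Sources: [Tan1999, §1, §4 Props. 4.1, 4.4]; [MoeglinWaldspurger1995, II.1.7, IV.1.8–IV.1.9]; [KudlaRallis1994, §1].
HONEST LABEL.  Count-neutral helper until tied; `HC_CM` is proved only modulo the 7 printed citations (2 remaining named inputs: hLiu418 = `stmt-HodgeConjecture-24832`,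
h413 = `stmt-HodgeConjecture-24833`) until rung 0 closes.
-/

set_option autoImplicit false
set_option linter.dupNamespace false -- the mandated namespace repeats `HodgeConjecture.HodgeConjecture`

noncomputable section

open scoped Matrix Topology ENNReal NNReal BigOperators
open NumberField IsDedekindDomain MeasureTheory Filter
open Literature.NumberTheory.Automorphic Literature.NumberTheory.GaloisRepresentations
open Literature.NumberTheory.GelbartRogawski1991 Literature.NumberTheory.GelbartRogawski1991.GRConstruction
open Literature.NumberTheory.K2Lit.SiegelDoubled Literature.MeasureTheory.Group

namespace Summit.HodgeConjecture.HodgeConjecture.Cruxes.HLiu418.K2LiuSiegelEisensteinConstantTermPackage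

open K2LiuSiegelUnipotentFourierDefs K2LiuConstantTermDelta
open K2LiuContinuationPackageAlgebra (exists_height_floor exists_ball_norm_le_of_continuous)
open K2LiuSiegelEisensteinContinuationTopKinds (le_max_mul_rpow add_add_le_merged_monomial)

/-! ## §1 A local bound from growth (continuity of the height, the floor; no local compactness) -/

section LocalBound

variable {X : Type*} [TopologicalSpace X]

/-- `hgt x ^ A ≤ max (B ^ A) (m ^ A)` for `m ≤ hgt x ≤ B`, `0 < m`, ANY real exponent `A` (split on the sign of `A`). [folklore] -/
theorem rpow_le_max_of_floor_ceiling {m B h A : ℝ} (hm : 0 < m) (hmh : m ≤ h) (hhB : h ≤ B) : h ^ A ≤ max (B ^ A) (m ^ A) := by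
  rcases le_or_gt 0 A with hA | hA
  · exact (Real.rpow_le_rpow (hm.le.trans hmh) hhB hA).trans (le_max_left _ _)
  · exact (Real.rpow_le_rpow_of_nonpos hm hmh hA.le).trans (le_max_right _ _)

/-- **LOCAL BOUND FROM GROWTH**: a continuous height with a positive floor and a growth letter `‖E s x‖ ≤ C·hgt x^A` (locally uniform in `s`, uniform in `x`, any signs) give Φ9's local
bound: near every `(z, x₀)`, `‖E s x‖ ≤ Mb` for `x` in the open neighbourhood `{hgt < hgt x₀ + 1}`. [cite: MoeglinWaldspurger1995, I.2.2, IV.1.9] -/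
theorem localBound_of_growth (hgt : X → ℝ) (hcont : Continuous hgt) {mfl : ℝ} (hmfl : 0 < mfl) (hfloor : ∀ x, mfl ≤ hgt x) (E : ℂ → X → ℂ)
    (hgr : ∀ z : ℂ, 0 < z.re → ∃ C A r : ℝ, 0 < r ∧ ∀ s : ℂ, dist s z < r → ∀ x, ‖E s x‖ ≤ C * hgt x ^ A) :
    ∀ z : ℂ, 0 < z.re → ∀ x₀ : X, ∃ r > (0 : ℝ), ∃ V ∈ 𝓝 x₀, ∃ Mb : ℝ, ∀ s : ℂ, dist s z < r → ∀ x ∈ V, ‖E s x‖ ≤ Mb := by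
  intro z hz x₀
  obtain ⟨C, A, r, hr, hle⟩ := hgr z hz
  refine ⟨r, hr, {x | hgt x < hgt x₀ + 1}, (isOpen_lt hcont continuous_const).mem_nhds (by show hgt x₀ < hgt x₀ + 1; linarith),
    max C 0 * max ((hgt x₀ + 1) ^ A) (mfl ^ A), fun s hs x hx => ?_⟩
  have hx0 : 0 ≤ hgt x := hmfl.le.trans (hfloor x)
  have hxB : hgt x ≤ hgt x₀ + 1 := le_of_lt hx
  calc ‖E s x‖ ≤ max C 0 * hgt x ^ A := le_max_mul_rpow hx0 (hle s hs x)
    _ ≤ max C 0 * max ((hgt x₀ + 1) ^ A) (mfl ^ A) :=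
        mul_le_mul_of_nonneg_left (rpow_le_max_of_floor_ceiling hmfl (hfloor x) hxB) (le_max_right _ _)

end LocalBound

/-! ## §2 The constant-term package -/

section Package

variable (L : Type) [Field L] [NumberField L] [IsCMField L] {N M n : ℕ} (e : Fin N × Fin M ≃ Fin n)
  (dV : Fin N → L) (hdV : ∀ i, IsCMField.complexConj L (dV i) = dV i)
  (dW : Fin M → L) (hdW : ∀ i, IsCMField.complexConj L (dW i) = dW i)
variable [MeasurableSpace (unipDelta L e dV hdV dW hdW)] [BorelSpace (unipDelta L e dV hdV dW hdW)]

set_option maxHeartbeats 400000 in -- MEASURED (as ★ O41.4 `constTerm_three_cells`): the orbit-quotient statement exceeds 200000 at `whnf`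
/-- **THE CONSTANT TERM, NORMALISED, IN THREE CELLS** (★ O41.4 + ★ Φ1 `fourierCoeffDelta_zero_index`): on the convergence half-plane,
`(E^Δ(·; f_s))_0(h) = f_s(h) + (∫β)⁻¹·M(s)f_s(h) + (∫β)⁻¹·MID(s,h)`. [cite: MoeglinWaldspurger1995, II.1.7] [cite: KudlaRallis1994, §1] -/
theorem fourierCoeffDelta_zero_three_cells (hn : 0 < n) (νN : Measure (unipDelta L e dV hdV dW hdW)) [νN.IsMulLeftInvariant]
    {β : unipDelta L e dV hdV dW hdW → ℝ≥0∞} (hβ : IsCoveringWeight (unipDeltaRat L e dV hdV dW hdW) β)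
    (hβ0 : ∫⁻ u, β u ∂νN ≠ 0) (hβtop : ∫⁻ u, β u ∂νN ≠ ∞)
    (wq : unipDeltaRat L e dV hdV dW hdW → ratH L e dV hdV dW hdW)
    (hwq : ∀ ν, ((wq ν : ratH L e dV hdV dW hdW) : HA L e dV hdV dW hdW) = weylDelta L e dV hdV dW hdW * ((ν : unipDelta L e dV hdV dW hdW) : HA L e dV hdV dW hdW))
    {χ : HeckeCharacter L} {s : ℂ} {f : HA L e dV hdV dW hdW → ℂ} (hf : IsSiegelDeltaSection L e dV hdV dW hdW χ s f) (hfc : Continuous f)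
    (h : HA L e dV hdV dW hdW)
    (hH : ∫⁻ u, (∑' q : SiegelDeltaQuot L e dV hdV dW hdW,
        ‖f ((((Quotient.out q : ratH L e dV hdV dW hdW) : HA L e dV hdV dW hdW)) * ((u : HA L e dV hdV dW hdW) * h))‖ₑ) * β u ∂νN ≠ ∞) :
    fourierCoeffDelta L e dV hdV dW hdW νN β 0 (eisensteinSeriesDelta L e dV hdV dW hdW f) h =
      f h + ((∫⁻ u, β u ∂νN).toReal⁻¹ : ℝ) • intertwiningDelta L e dV hdV dW hdW νN f h +
        ((∫⁻ u, β u ∂νN).toReal⁻¹ : ℝ) • ∫ u, (β u).toReal • (∑' q : ↥(({Quotient.mk (MulAction.orbitRel (siegelDeltaRat L e dV hdV dW hdW) (ratH L e dV hdV dW hdW)) 1} ∪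
            Set.range (fun ν : unipDeltaRat L e dV hdV dW hdW =>
              (Quotient.mk (MulAction.orbitRel (siegelDeltaRat L e dV hdV dW hdW) (ratH L e dV hdV dW hdW)) (wq ν) :
                SiegelDeltaQuot L e dV hdV dW hdW)))ᶜ : Set (SiegelDeltaQuot L e dV hdV dW hdW)),
          f ((((Quotient.out (q : SiegelDeltaQuot L e dV hdV dW hdW) : ratH L e dV hdV dW hdW) : HA L e dV hdV dW hdW)) *
            ((u : HA L e dV hdV dW hdW) * h))) ∂νN := by
  have hc : (∫⁻ u, β u ∂νN).toReal ≠ 0 := ENNReal.toReal_ne_zero.2 ⟨hβ0, hβtop⟩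
  have hint : (∫ u, (β u).toReal ∂νN) = (∫⁻ u, β u ∂νN).toReal :=
    integral_toReal hβ.measurable.aemeasurable (ae_lt_top hβ.measurable hβtop)
  rw [fourierCoeffDelta_zero_index, constTerm_three_cells wq hwq hn νN hβ hf hfc h hH, hint, smul_add, smul_add, smul_smul, inv_mul_cancel₀ hc, one_smul]

set_option maxHeartbeats 400000 in
/-- **EDITION 4a — THE KIND-0 PACKAGE FROM THE THREE CELLS.**  Fixed carrier `(νN, β)`; a family of continuous Siegel sections `f_s ∈ I_Δ(s, χ)` holomorphic in `s` on `{0 < re}` (`hfd`,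
★ `IsHolomorphicSectionFamily`) with the growth letter `hfgr` (G7) and O41.4's finiteness `hH` on the convergence half-plane; the BIG-CELL package `E₈` (★ Φ8's output: (i)(ii),
(iv) `E₈ s h = (∏(s−p))·(∫β)⁻¹·M(s)f_s(h)` on `{n∕2 < re}`, (v)) and the MIDDLE package `E₇` (★ G5-a's output, (iv) relative to `(∫β)⁻¹·MID(s,h)`), BY VALUE.  THEN
`Ec₀ := (∏_{p∈P}(s−p))·f_s(h) + E₈ + E₇` satisfies the five KIND-0 binders of ★ `siegelEisensteinContinuation_of_kinds_fixedCarrier`: holomorphy, continuity, the coefficient identity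
`Ec₀ s h = (∏(s−p))·(E^Δ(·; f_s))_0(h)` on `{n∕2 < re}`, a local bound near every `(z, h₀)`, and growth in ★ `adelicHeightGL`.
[cite: Tan1999, §4 Props. 4.1, 4.4] [cite: MoeglinWaldspurger1995, II.1.7, IV.1.8–IV.1.9] [cite: KudlaRallis1994, §1] -/
theorem exists_constantTerm_package (hn : 0 < n) (νN : Measure (unipDelta L e dV hdV dW hdW)) [νN.IsMulLeftInvariant]
    {β : unipDelta L e dV hdV dW hdW → ℝ≥0∞} (hβ : IsCoveringWeight (unipDeltaRat L e dV hdV dW hdW) β)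
    (hβ0 : ∫⁻ u, β u ∂νN ≠ 0) (hβtop : ∫⁻ u, β u ∂νN ≠ ∞)
    (wq : unipDeltaRat L e dV hdV dW hdW → ratH L e dV hdV dW hdW)
    (hwq : ∀ ν, ((wq ν : ratH L e dV hdV dW hdW) : HA L e dV hdV dW hdW) = weylDelta L e dV hdV dW hdW * ((ν : unipDelta L e dV hdV dW hdW) : HA L e dV hdV dW hdW))
    {χ : HeckeCharacter L} (f : ℂ → HA L e dV hdV dW hdW → ℂ) (hf : ∀ s, IsSiegelDeltaSection L e dV hdV dW hdW χ s (f s)) (hfc : ∀ s, Continuous (f s))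
    (hfd : ∀ h : HA L e dV hdV dW hdW, DifferentiableOn ℂ (fun s => f s h) {s : ℂ | 0 < s.re})
    (hfgr : ∀ z : ℂ, 0 < z.re → ∃ C A r : ℝ, 0 < r ∧ ∀ s : ℂ, dist s z < r → ∀ h : HA L e dV hdV dW hdW,
      ‖f s h‖ ≤ C * adelicHeightGL (n + n) L (h : GL (Fin (n + n)) (AdeleRing (𝓞 L) L)) ^ A)
    (hH : ∀ (s : ℂ) (h : HA L e dV hdV dW hdW), (n : ℝ) / 2 < s.re → ∫⁻ u, (∑' q : SiegelDeltaQuot L e dV hdV dW hdW,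
        ‖f s ((((Quotient.out q : ratH L e dV hdV dW hdW) : HA L e dV hdV dW hdW)) * ((u : HA L e dV hdV dW hdW) * h))‖ₑ) * β u ∂νN ≠ ∞)
    (P : Finset ℂ)
    -- the big-cell package (★ Φ8's output), by value
    (E₈ : ℂ → HA L e dV hdV dW hdW → ℂ) (h8d : ∀ h : HA L e dV hdV dW hdW, DifferentiableOn ℂ (fun s => E₈ s h) {s : ℂ | 0 < s.re})
    (h8c : ∀ s : ℂ, 0 < s.re → Continuous (E₈ s))
    (h8eq : ∀ (s : ℂ) (h : HA L e dV hdV dW hdW), (n : ℝ) / 2 < s.re →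
      E₈ s h = (∏ p ∈ P, (s - p)) * (((∫⁻ u, β u ∂νN).toReal⁻¹ : ℝ) • intertwiningDelta L e dV hdV dW hdW νN (f s) h))
    (h8g : ∀ z : ℂ, 0 < z.re → ∃ C A r : ℝ, 0 < r ∧ ∀ s : ℂ, dist s z < r → ∀ h : HA L e dV hdV dW hdW,
      ‖E₈ s h‖ ≤ C * adelicHeightGL (n + n) L (h : GL (Fin (n + n)) (AdeleRing (𝓞 L) L)) ^ A)
    -- the middle-cell package (★ G5-a's output), by value
    (E₇ : ℂ → HA L e dV hdV dW hdW → ℂ) (h7d : ∀ h : HA L e dV hdV dW hdW, DifferentiableOn ℂ (fun s => E₇ s h) {s : ℂ | 0 < s.re})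
    (h7c : ∀ s : ℂ, 0 < s.re → Continuous (E₇ s))
    (h7eq : ∀ (s : ℂ) (h : HA L e dV hdV dW hdW), (n : ℝ) / 2 < s.re →
      E₇ s h = (∏ p ∈ P, (s - p)) * (((∫⁻ u, β u ∂νN).toReal⁻¹ : ℝ) • ∫ u, (β u).toReal •
        (∑' q : ↥(({Quotient.mk (MulAction.orbitRel (siegelDeltaRat L e dV hdV dW hdW) (ratH L e dV hdV dW hdW)) 1} ∪
            Set.range (fun ν : unipDeltaRat L e dV hdV dW hdW =>
              (Quotient.mk (MulAction.orbitRel (siegelDeltaRat L e dV hdV dW hdW) (ratH L e dV hdV dW hdW)) (wq ν) :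
                SiegelDeltaQuot L e dV hdV dW hdW)))ᶜ : Set (SiegelDeltaQuot L e dV hdV dW hdW)),
          f s ((((Quotient.out (q : SiegelDeltaQuot L e dV hdV dW hdW) : ratH L e dV hdV dW hdW) : HA L e dV hdV dW hdW)) *
            ((u : HA L e dV hdV dW hdW) * h))) ∂νN))
    (h7g : ∀ z : ℂ, 0 < z.re → ∃ C A r : ℝ, 0 < r ∧ ∀ s : ℂ, dist s z < r → ∀ h : HA L e dV hdV dW hdW,
      ‖E₇ s h‖ ≤ C * adelicHeightGL (n + n) L (h : GL (Fin (n + n)) (AdeleRing (𝓞 L) L)) ^ A) :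
    ∃ Ec₀ : ℂ → HA L e dV hdV dW hdW → ℂ,
      (∀ h : HA L e dV hdV dW hdW, DifferentiableOn ℂ (fun s => Ec₀ s h) {s : ℂ | 0 < s.re}) ∧
      (∀ s : ℂ, 0 < s.re → Continuous (Ec₀ s)) ∧
      (∀ (s : ℂ) (h : HA L e dV hdV dW hdW), (n : ℝ) / 2 < s.re →
        Ec₀ s h = (∏ p ∈ P, (s - p)) * fourierCoeffDelta L e dV hdV dW hdW νN β 0 (eisensteinFamilyDelta L e dV hdV dW hdW f s) h) ∧
      (∀ z : ℂ, 0 < z.re → ∀ h₀ : HA L e dV hdV dW hdW, ∃ r > (0 : ℝ), ∃ V ∈ 𝓝 h₀, ∃ Mb : ℝ,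
        ∀ s : ℂ, dist s z < r → ∀ h ∈ V, ‖Ec₀ s h‖ ≤ Mb) ∧
      (∀ z : ℂ, 0 < z.re → ∃ C A r : ℝ, 0 < r ∧ ∀ s : ℂ, dist s z < r → ∀ h : HA L e dV hdV dW hdW,
        ‖Ec₀ s h‖ ≤ C * adelicHeightGL (n + n) L (h : GL (Fin (n + n)) (AdeleRing (𝓞 L) L)) ^ A) := by
  set hgt : HA L e dV hdV dW hdW → ℝ := fun h => adelicHeightGL (n + n) L (h : GL (Fin (n + n)) (AdeleRing (𝓞 L) L)) with hhgt
  have hgtc : Continuous hgt := continuous_adelicHeightGL.comp continuous_subtype_val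
  obtain ⟨mfl, hmfl, hfloor⟩ := exists_height_floor L e dV hdV dW hdW hn
  set Ec₀ : ℂ → HA L e dV hdV dW hdW → ℂ := fun s h => (∏ p ∈ P, (s - p)) * f s h + E₈ s h + E₇ s h with hEc₀
  -- (v) growth: three monomials merged under the floor, the polynomial prefix bounded on the ball
  have hgr : ∀ z : ℂ, 0 < z.re → ∃ C A r : ℝ, 0 < r ∧ ∀ s : ℂ, dist s z < r → ∀ h : HA L e dV hdV dW hdW, ‖Ec₀ s h‖ ≤ C * hgt h ^ A := by
    intro z hz
    obtain ⟨Cf, Af, rf, hrf, hfle⟩ := hfgr z hz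
    obtain ⟨C₈, A₈, r₈, hr₈, h8le⟩ := h8g z hz
    obtain ⟨C₇, A₇, r₇, hr₇, h7le⟩ := h7g z hz
    obtain ⟨δ, hδ, hpoly⟩ := exists_ball_norm_le_of_continuous (a := fun s : ℂ => ∏ p ∈ P, (s - p)) (by fun_prop) z
    set Kp : ℝ := ‖∏ p ∈ P, (z - p)‖ + 1 with hKp
    have hKp0 : 0 ≤ Kp := by positivity
    -- merged constant and exponent (point-independent)
    obtain ⟨C, A, hC, hmerge⟩ : ∃ C A : ℝ, 0 ≤ C ∧ ∀ h : HA L e dV hdV dW hdW, ∀ s : ℂ, dist s z < min (min rf δ) (min r₈ r₇) →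
        ‖Ec₀ s h‖ ≤ C * hgt h ^ A := by
      refine ⟨(Kp * max Cf 0 * mfl ^ (Af - max Af A₈) + max C₈ 0 * mfl ^ (A₈ - max Af A₈)) * mfl ^ (max Af A₈ - max (max Af A₈) A₇) +
          max C₇ 0 * mfl ^ (A₇ - max (max Af A₈) A₇), max (max Af A₈) A₇, by positivity, fun h s hs => ?_⟩
      have hsf : dist s z < rf := lt_of_lt_of_le hs ((min_le_left _ _).trans (min_le_left _ _))
      have hsδ : dist s z < δ := lt_of_lt_of_le hs ((min_le_left _ _).trans (min_le_right _ _))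
      have hs₈ : dist s z < r₈ := lt_of_lt_of_le hs ((min_le_right _ _).trans (min_le_left _ _))
      have hs₇ : dist s z < r₇ := lt_of_lt_of_le hs ((min_le_right _ _).trans (min_le_right _ _))
      have hx : 0 ≤ hgt h := hmfl.le.trans (hfloor h)
      have hu : ‖(∏ p ∈ P, (s - p)) * f s h‖ ≤ Kp * max Cf 0 * hgt h ^ Af := by
        rw [norm_mul, mul_assoc]
        exact mul_le_mul (hpoly s hsδ) (le_max_mul_rpow hx (hfle s hsf h)) (norm_nonneg _) hKp0
      have hv : ‖E₈ s h‖ ≤ max C₈ 0 * hgt h ^ A₈ := le_max_mul_rpow hx (h8le s hs₈ h)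
      have hw : ‖E₇ s h‖ ≤ max C₇ 0 * hgt h ^ A₇ := le_max_mul_rpow hx (h7le s hs₇ h)
      have h1 := K2LiuRankOneInnerWhittakerContinued.add_le_merged_monomial hmfl (hfloor h) (by positivity) (le_max_right _ _) hu hv
      have h2 := K2LiuRankOneInnerWhittakerContinued.add_le_merged_monomial hmfl (hfloor h) (by positivity) (le_max_right _ _) h1 hw
      calc ‖Ec₀ s h‖ ≤ ‖(∏ p ∈ P, (s - p)) * f s h + E₈ s h‖ + ‖E₇ s h‖ := norm_add_le _ _
        _ ≤ ‖(∏ p ∈ P, (s - p)) * f s h‖ + ‖E₈ s h‖ + ‖E₇ s h‖ := add_le_add (norm_add_le _ _) le_rfl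
        _ ≤ _ := h2
    exact ⟨C, A, min (min rf δ) (min r₈ r₇), lt_min (lt_min hrf hδ) (lt_min hr₈ hr₇), fun s hs h => hmerge h s hs⟩
  refine ⟨Ec₀, fun h => ?_, fun s hs => ?_, fun s h hs => ?_, localBound_of_growth hgt hgtc hmfl hfloor Ec₀ hgr, hgr⟩
  · -- (i) holomorphy
    exact (((DifferentiableOn.fun_finsetProd fun p _ => differentiableOn_id.sub_const p).mul (hfd h)).add (h8d h)).add (h7d h)
  · -- (ii) continuity
    exact ((continuous_const.mul (hfc s)).add (h8c s hs)).add (h7c s hs)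
  · -- the coefficient identity from the three cells
    show (∏ p ∈ P, (s - p)) * f s h + E₈ s h + E₇ s h = (∏ p ∈ P, (s - p)) * fourierCoeffDelta L e dV hdV dW hdW νN β 0 (eisensteinFamilyDelta L e dV hdV dW hdW f s) h
    rw [h8eq s h hs, h7eq s h hs, show eisensteinFamilyDelta L e dV hdV dW hdW f s = eisensteinSeriesDelta L e dV hdV dW hdW (f s) from rfl,
      fourierCoeffDelta_zero_three_cells L e dV hdV dW hdW hn νN hβ hβ0 hβtop wq hwq (hf s) (hfc s) h (hH s h hs)]
    ring

end Package

end Summit.HodgeConjecture.HodgeConjecture.Cruxes.HLiu418.K2LiuSiegelEisensteinConstantTermPackage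

end
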